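import Literature.NumberTheory.DiophantineGeometry.CafureMatera
import Literature.NumberTheory.DiophantineGeometry.CafureMateraLemma22ResultantProofs
import Literature.NumberTheory.DiophantineGeometry.CafureMateraLemma22MultiplicityProofs
import Literature.NumberTheory.DiophantineGeometry.CafureMateraLemma22DirectionProofs
import Mathlib.Algebra.MvPolynomial.Nilpotent
import HarnessLib

/-!
# Proof of `Literature.NumberTheory.DiophantineGeometry.CafureMatera2006_lemma22` (Cafure–Matera 2006, Lemma 2.2, `s = 2`)

This file discharges the named fact `CafureMatera2006_lemma22` of `CafureMatera.lean`:
two nonzero `f, g ∈ 𝔽_q[X₁,…,X_N]` of total degree `≤ δ` (`δ > 0`) that are relatively prime in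
`𝔽̄_q[X₁,…,X_N]` have at most `δ² q^{N-2}` common zeros in `𝔽_q^N`. No statement is changed; this
file and its three support files (`CafureMateraLemma22{Resultant,Multiplicity,Direction}Proofs`)
only add proofs (here: the effect of the linear substitution of part C on degrees, evaluation and
the `X_0`-leading coefficient, the reductions, and the assembly).

## Source and route

A. Cafure, G. Matera, Finite Fields Appl. 12 (2006), Lemma 2.2 (p. 159–160), verbatim proof:
"Since `f₁, f₂` have no common factors in `𝔽̄_q[X₁,…,Xₙ]`, we have that `V(f₁, f₂)` is an
`𝔽_q`-variety of dimension `n − 2`. From the Bézout inequality (7) we conclude that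
`deg V(f₁, f₂) ≤ δ²` holds. Then Lemma 2.1 shows that `#(V(f₁, f₂) ∩ 𝔽_qⁿ) ≤ δ² q^{n−2}` holds."
(Lemma 2.1 = `#(V ∩ 𝔽_qⁿ) ≤ deg V · q^{dim V}`, from Heintz–Schnorr [HS82, Prop. 2.3]; (7) = the
Bézout inequality of [Hei83].)

DEVIATION. Mathlib (v4.32) has no dimension/degree theory of affine varieties and no Bézout
inequality, so the printed two-line proof cannot be followed literally. We prove the same
statement, with the same sharp constant `δ²`, by an elementary elimination argument (the authors
remark, loc. cit., that Schmidt's elementary bounds give only `2nδ³ q^{n-2}` and `δ³ q^{n-2}`; the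
multiplicity count below is what recovers `δ²`):

1. `IsRelPrime` over `𝔽̄_q` implies `IsRelPrime` over `𝔽_q` (`isRelPrime_of_map`); `N = 0` and
   `deg f = 0` are trivial; if `q ≤ d := deg f` then `#Z ≤ #{g = 0} ≤ δ q^{N-1} ≤ δ² q^{N-2}` by
   Schwartz–Zippel (Mathlib).
2. `1 ≤ d < q`: Schwartz–Zippel applied to the top homogeneous part of `f` gives `v ∈ 𝔽_q^N` with
   `coeff_{t^d} f(tv) ≠ 0`; after swapping two variables (`v_0 ≠ 0`), scaling `f` by a constant,
   and the `𝔽_q`-linear automorphism `X_0 ↦ v_0X_0, X_j ↦ X_j + v_jX_0` (all of which preserve the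
   count, the degrees and coprimality), `F := f` viewed in `A[t]` (`t = X_0`, `A = 𝔽_q[X_1..X_n]`,
   `n = N - 1`) is monic of `t`-degree `d`, and `G := g ∈ A[t]` has `t`-degree `≤ δ`.
3. `R := Res_t(F, G) ∈ A` (Sylvester resultant): `R ≠ 0` (coprimality), `deg R ≤ d δ`, and for
   every `a ∈ 𝔽_q^n`, `R ∈ 𝔪_a^{k(a)}` where `k(a)` = number of common roots `t ∈ 𝔽_q` of
   `F(a,t), G(a,t)` (part A).
4. `#Z = ∑_a k(a) ≤ ∑_a ord_a R ≤ deg R · q^{n-1} ≤ d δ q^{n-1} ≤ δ² q^{N-2}` by the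
   Schwartz–Zippel lemma with multiplicity of Dvir–Kopparty–Saraf–Sudan (part B,
   [cite: DvirEtAl2013, Lemma 2.7]).

## References

* [CafureMatera2006] A. Cafure, G. Matera, Improved explicit estimates on the number of solutions
  of equations over a finite field, Finite Fields Appl. 12 (2006) 155–185, Lemma 2.1, Lemma 2.2.
* [DvirEtAl2013] Z. Dvir, S. Kopparty, S. Saraf, M. Sudan, Extensions to the method of
  multiplicities, with applications to Kakeya sets and mergers, SIAM J. Comput. 42 (2013)
  2305–2328, Lemma 2.7.
-/

namespace Literature.NumberTheory.DiophantineGeometry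

open MvPolynomial CafureMateraLemma22

open scoped Polynomial

namespace CafureMateraLemma22

variable {K : Type*} [Field K]

/-- Relatively prime after extension of scalars to a bigger field ⇒ relatively prime. [folklore] -/
theorem isRelPrime_of_map {L : Type*} [Field L] (ι : K →+* L) {σ : Type*}
    {f g : MvPolynomial σ K} (h : IsRelPrime (map ι f) (map ι g)) : IsRelPrime f g := by
  intro d hf hg
  have hu : IsUnit (map ι d) := h (map_dvd (map ι) hf) (map_dvd (map ι) hg)
  rw [isUnit_iff_totalDegree_of_isReduced] at hu ⊢
  obtain ⟨h1, h2⟩ := hu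
  refine ⟨?_, ?_⟩
  · rw [coeff_map] at h1
    refine isUnit_iff_ne_zero.2 fun hc => ?_
    rw [hc, map_zero] at h1
    exact not_isUnit_zero h1
  · have : (map ι d).totalDegree = d.totalDegree := by
      simp only [totalDegree, support_map_of_injective _ ι.injective]
    omega

/-! ### The linear substitution: degrees, evaluation, leading coefficient in `X_0` -/

/-- The substitution `X_0 ↦ v_0 X_0`, `X_{j+1} ↦ X_{j+1} + v_{j+1} X_0` does not increase the total
degree. [folklore] -/
theorem totalDegree_dirSubst_le {n : ℕ} (v : Fin (n + 1) → K) (p : MvPolynomial (Fin (n + 1)) K) :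
    (aeval (Fin.cases (C (v 0) * X 0) (fun j => X j.succ + C (v j.succ) * X 0) :
      Fin (n + 1) → MvPolynomial (Fin (n + 1)) K) p).totalDegree ≤ p.totalDegree := by
  refine totalDegree_aeval_le_of_le_one _ (fun i => ?_) p
  refine Fin.cases ?_ (fun j => ?_) i
  · simp only [Fin.cases_zero]
    exact (totalDegree_mul _ _).trans (by simp)
  · simp only [Fin.cases_succ]
    refine (totalDegree_add _ _).trans (max_le (by simp) ?_)
    exact (totalDegree_mul _ _).trans (by simp)

/-- Evaluating after the substitution = evaluating at the linearly transformed point. [folklore] -/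
theorem eval_dirSubst {n : ℕ} (v : Fin (n + 1) → K) (p : MvPolynomial (Fin (n + 1)) K)
    (x : Fin (n + 1) → K) :
    eval x (aeval (Fin.cases (C (v 0) * X 0) (fun j => X j.succ + C (v j.succ) * X 0) :
      Fin (n + 1) → MvPolynomial (Fin (n + 1)) K) p) =
      eval (Fin.cases (v 0 * x 0) (fun j => x j.succ + v j.succ * x 0) : Fin (n + 1) → K) p := by
  have h : (fun i => eval x ((Fin.cases (C (v 0) * X 0) (fun j => X j.succ + C (v j.succ) * X 0) :
      Fin (n + 1) → MvPolynomial (Fin (n + 1)) K) i)) =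
      (Fin.cases (v 0 * x 0) (fun j => x j.succ + v j.succ * x 0) : Fin (n + 1) → K) := by
    funext i
    refine Fin.cases ?_ (fun j => ?_) i <;> simp
  rw [eval_aeval_apply, h]


/-- Restricting the substituted polynomial to the `X_0`-axis gives `f` along the line `t ↦ t v`.
[folklore] -/
theorem map_eval_zero_finSuccEquiv_dirSubst {n : ℕ} (v : Fin (n + 1) → K)
    (f : MvPolynomial (Fin (n + 1)) K) :
    Polynomial.map (eval (0 : Fin n → K)) (finSuccEquiv K n
      (aeval (Fin.cases (C (v 0) * X 0) (fun j => X j.succ + C (v j.succ) * X 0) :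
        Fin (n + 1) → MvPolynomial (Fin (n + 1)) K) f)) =
      aeval (fun i => Polynomial.C (v i) * Polynomial.X) f := by
  let L : MvPolynomial (Fin (n + 1)) K →ₐ[K] K[X] :=
    (Polynomial.mapAlgHom (aeval (0 : Fin n → K))).comp ((finSuccEquiv K n).toAlgHom.comp
      (aeval (Fin.cases (C (v 0) * X 0) (fun j => X j.succ + C (v j.succ) * X 0) :
        Fin (n + 1) → MvPolynomial (Fin (n + 1)) K)))
  let R : MvPolynomial (Fin (n + 1)) K →ₐ[K] K[X] :=
    aeval (fun i => Polynomial.C (v i) * Polynomial.X)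
  have hC : ∀ c : K, finSuccEquiv K n (C c) = Polynomial.C (C c) := fun c => by
    simp [finSuccEquiv_apply]
  have hLR : L = R := by
    refine MvPolynomial.algHom_ext fun i => ?_
    refine Fin.cases ?_ (fun j => ?_) i
    · simp [L, R, finSuccEquiv_X_zero, hC, Polynomial.coe_mapAlgHom, coe_aeval_eq_eval]
    · simp [L, R, finSuccEquiv_X_zero, finSuccEquiv_X_succ, hC,
        Polynomial.coe_mapAlgHom, coe_aeval_eq_eval]
  have := congrArg (fun ψ => ψ f) hLR
  simpa [L, R, Polynomial.coe_mapAlgHom, coe_aeval_eq_eval] using this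

/-- **The leading coefficient in `X_0` after the substitution.** If `deg f ≤ d`, the coefficient
of `X_0^d` in the substituted polynomial is the constant `c = ` (coefficient of `t^d` in `f(tv)`).
[folklore] -/
theorem coeff_finSuccEquiv_dirSubst {n : ℕ} (v : Fin (n + 1) → K)
    (f : MvPolynomial (Fin (n + 1)) K) {d : ℕ} (hfd : f.totalDegree ≤ d) :
    (finSuccEquiv K n
      (aeval (Fin.cases (C (v 0) * X 0) (fun j => X j.succ + C (v j.succ) * X 0) :
        Fin (n + 1) → MvPolynomial (Fin (n + 1)) K) f)).coeff d =
      C ((aeval (fun i => Polynomial.C (v i) * Polynomial.X) f).coeff d) := by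
  set Φ := aeval (Fin.cases (C (v 0) * X 0) (fun j => X j.succ + C (v j.succ) * X 0) :
        Fin (n + 1) → MvPolynomial (Fin (n + 1)) K) f with hΦ
  set cd := (finSuccEquiv K n Φ).coeff d with hcd
  have hΦdeg : Φ.totalDegree ≤ d := (totalDegree_dirSubst_le v f).trans hfd
  have hcdC : cd = C (coeff 0 cd) := by
    by_cases h0 : cd = 0
    · rw [h0, coeff_zero, map_zero]
    · rw [← totalDegree_eq_zero_iff_eq_C]
      have := totalDegree_coeff_finSuccEquiv_add_le Φ d h0
      rw [← hcd] at this
      omega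
  rw [hcdC, ← map_eval_zero_finSuccEquiv_dirSubst v f, Polynomial.coeff_map, ← constantCoeff_eq,
    ← eval_zero]

variable [Fintype K] [DecidableEq K]

/-- Counting points through a bijection of the ambient finite set. [folklore] -/
theorem card_filter_comp {α : Type*} [Fintype α] (ψ : α → α) (hψ : Function.Bijective ψ)
    (P : α → Prop) [DecidablePred P] :
    (Finset.univ.filter fun x => P (ψ x)).card = (Finset.univ.filter P).card := by
  refine Finset.card_bij (fun x _ => ψ x) (fun x hx => ?_) (fun x _ y _ h => hψ.1 h)
    (fun y hy => ?_)
  · simpa using hx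
  · obtain ⟨x, rfl⟩ := hψ.2 y
    exact ⟨x, by simpa using hy, rfl⟩

/-- Fibre decomposition of a count over `α^{n+1}` along the first coordinate. [folklore] -/
theorem card_filter_eq_sum_cons {α : Type*} [Fintype α] {n : ℕ} (P : (Fin (n + 1) → α) → Prop)
    [DecidablePred P] :
    (Finset.univ.filter P).card =
      ∑ a : Fin n → α, (Finset.univ.filter fun t : α => P (Fin.cons t a)).card := by
  simp only [Finset.card_filter]
  rw [← Fintype.sum_equiv (Fin.consEquiv fun _ => α)
    (fun st => if P (Fin.cons st.1 st.2) then 1 else 0) _ (fun st => rfl), Fintype.sum_prod_type,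
    Finset.sum_comm]

/-- **Main estimate** (Cafure–Matera Lemma 2.2 for two polynomials, coprime over the ground field,
all numbers of variables): `#{x ∈ 𝔽_q^N : f(x) = g(x) = 0} ≤ δ² q^{N-2}`. See the module docstring
for the route. [cite: CafureMatera2006, Lemma 2.2] -/
theorem card_commonZero_le :
    ∀ (N δ : ℕ) (f g : MvPolynomial (Fin N) K), f ≠ 0 → g ≠ 0 → 0 < δ → f.totalDegree ≤ δ →
      g.totalDegree ≤ δ → IsRelPrime f g →
      (Finset.univ.filter fun x : Fin N → K => eval x f = 0 ∧ eval x g = 0).card ≤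
        δ ^ 2 * Fintype.card K ^ (N - 2)
  | 0, δ, f, g, hf, hg, hδ, hfd, hgd, hcop => by
    have hf0 : ∀ x : Fin 0 → K, eval x f ≠ 0 := by
      intro x hx
      apply hf
      rw [f.eq_C_of_isEmpty] at hx ⊢
      rw [eval_C] at hx
      rw [hx, map_zero]
    rw [Finset.filter_false_of_mem fun x _ h => hf0 x h.1]
    simp
  | n + 1, δ, f, g, hf, hg, hδ, hfd, hgd, hcop => by
    set q := Fintype.card K with hq
    have hq1 : 1 ≤ q := Fintype.card_pos
    set d := f.totalDegree with hd
    -- Case `d = 0`: `f` is a nonzero constant, no zeros at all.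
    by_cases hd0 : d = 0
    · have hfC : f = C (coeff 0 f) := totalDegree_eq_zero_iff_eq_C.1 hd0
      have hc : coeff 0 f ≠ 0 := fun h => hf (by rw [hfC, h, map_zero])
      rw [Finset.filter_false_of_mem]
      · simp
      · intro x _ h
        rw [hfC, eval_C] at h
        exact hc h.1
    -- Case `q ≤ d`: the trivial bound via the zeros of `g` alone.
    by_cases hdq : q ≤ d
    · calc (Finset.univ.filter fun x : Fin (n + 1) → K => eval x f = 0 ∧ eval x g = 0).card
          ≤ (Finset.univ.filter fun x : Fin (n + 1) → K => eval x g = 0).card :=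
            Finset.card_le_card (Finset.monotone_filter_right _ fun x _ h => h.2)
        _ ≤ g.totalDegree * q ^ (n + 1 - 1) := card_eval_eq_zero_le hg (Nat.le_add_left 1 n)
        _ ≤ δ * q ^ n := by rw [Nat.add_sub_cancel]; gcongr
        _ ≤ δ ^ 2 * q ^ (n + 1 - 2) := by
            cases n with
            | zero =>
              rw [show 0 + 1 - 2 = 0 from rfl, pow_zero, mul_one, mul_one, sq]
              exact Nat.le_mul_of_pos_left δ hδ
            | succ m =>
              rw [show m + 1 + 1 - 2 = m by omega, pow_succ, sq]
              calc δ * (q ^ m * q) = δ * q * q ^ m := by ring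
                _ ≤ δ * δ * q ^ m := by gcongr; omega
    -- Main case `1 ≤ d < q`.
    have hdq' : f.totalDegree < q := not_le.1 hdq
    obtain ⟨v, hv⟩ := exists_coeff_line_ne_zero hf hdq'
    obtain ⟨i₀, hi₀⟩ := exists_apply_ne_zero_of_coeff_line (d := d) (by omega) hv
    -- Step 1: swap the variables `0` and `i₀`.
    set e := Equiv.swap (0 : Fin (n + 1)) i₀ with he
    set f₁ := rename e f with hf₁
    set g₁ := rename e g with hg₁
    set v₁ : Fin (n + 1) → K := v ∘ e with hv₁
    have hv₁0 : v₁ 0 ≠ 0 := by simpa [v₁, e] using hi₀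
    have hf₁0 : f₁ ≠ 0 := fun h =>
      hf (rename_injective _ e.injective (by rw [map_zero]; exact h))
    have hg₁0 : g₁ ≠ 0 := fun h =>
      hg (rename_injective _ e.injective (by rw [map_zero]; exact h))
    have hf₁d : f₁.totalDegree = d := totalDegree_renameEquiv e f
    have hg₁d : g₁.totalDegree ≤ δ := (totalDegree_renameEquiv e g).le.trans hgd
    have hcop₁ : IsRelPrime f₁ g₁ := isRelPrime_map_mulEquiv (renameEquiv K e).toMulEquiv hcop
    have hline₁ : aeval (fun i => Polynomial.C (v₁ i) * Polynomial.X) f₁ =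
        aeval (fun i => Polynomial.C (v i) * Polynomial.X) f := by
      have hfun : (fun i => Polynomial.C (v₁ i) * Polynomial.X) ∘ e =
          fun i => Polynomial.C (v i) * Polynomial.X := by
        funext j
        simp [v₁, e, Equiv.swap_apply_self]
      rw [hf₁, aeval_rename, hfun]
    have hv₁c : (aeval (fun i => Polynomial.C (v₁ i) * Polynomial.X) f₁).coeff d ≠ 0 := by
      rw [hline₁]; exact hv
    have hZ₁ : (Finset.univ.filter fun x : Fin (n + 1) → K => eval x f = 0 ∧ eval x g = 0).card =
        (Finset.univ.filter fun x : Fin (n + 1) → K => eval x f₁ = 0 ∧ eval x g₁ = 0).card := by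
      have hψ : Function.Bijective fun x : Fin (n + 1) → K => x ∘ e := by
        refine Function.bijective_iff_has_inverse.2 ⟨fun x => x ∘ e.symm, fun x => ?_, fun x => ?_⟩
        · simp [Function.comp_assoc]
        · simp [Function.comp_assoc]
      rw [← card_filter_comp _ hψ (fun x : Fin (n + 1) → K => eval x f = 0 ∧ eval x g = 0)]
      simp only [f₁, g₁, eval_rename]
    rw [hZ₁]
    -- Step 2: normalise the leading coefficient along the line, then substitute.
    set c := (aeval (fun i => Polynomial.C (v₁ i) * Polynomial.X) f₁).coeff d with hc
    set f₁' : MvPolynomial (Fin (n + 1)) K := C c⁻¹ * f₁ with hf₁'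
    have hcu : IsUnit (C c⁻¹ : MvPolynomial (Fin (n + 1)) K) :=
      (isUnit_iff_ne_zero.2 (inv_ne_zero hv₁c)).map C
    have hf₁'0 : f₁' ≠ 0 := mul_ne_zero (C_ne_zero.2 (inv_ne_zero hv₁c)) hf₁0
    have hf₁'d : f₁'.totalDegree ≤ d := by
      calc f₁'.totalDegree ≤ (C c⁻¹ : MvPolynomial (Fin (n + 1)) K).totalDegree + f₁.totalDegree :=
            totalDegree_mul _ _
        _ = d := by rw [totalDegree_C, zero_add, hf₁d]
    have hcop₁' : IsRelPrime f₁' g₁ := (isRelPrime_mul_unit_left_left hcu).2 hcop₁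
    have hline' : (aeval (fun i => Polynomial.C (v₁ i) * Polynomial.X) f₁').coeff d = 1 := by
      rw [hf₁', map_mul, aeval_C, Polynomial.algebraMap_apply, Algebra.algebraMap_self,
        RingHom.id_apply, Polynomial.coeff_C_mul, ← hc, inv_mul_cancel₀ hv₁c]
    have hZ₁' : (Finset.univ.filter fun x : Fin (n + 1) → K => eval x f₁ = 0 ∧ eval x g₁ = 0).card =
        (Finset.univ.filter fun x : Fin (n + 1) → K => eval x f₁' = 0 ∧ eval x g₁ = 0).card := by
      congr 1
      refine Finset.filter_congr fun x _ => ?_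
      rw [hf₁', map_mul, eval_C]
      constructor
      · rintro ⟨h1, h2⟩
        exact ⟨by rw [h1, mul_zero], h2⟩
      · rintro ⟨h1, h2⟩
        exact ⟨(mul_eq_zero.1 h1).resolve_left (inv_ne_zero hv₁c), h2⟩
    rw [hZ₁']
    -- Step 3: the linear substitution making `X 0` point along `v₁`.
    set φ : MvPolynomial (Fin (n + 1)) K →ₐ[K] MvPolynomial (Fin (n + 1)) K :=
      aeval (Fin.cases (C (v₁ 0) * X 0) (fun j => X j.succ + C (v₁ j.succ) * X 0)) with hφ
    set f₂ := φ f₁' with hf₂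
    set g₂ := φ g₁ with hg₂
    have hφinj : Function.Injective φ := (dirSubst_bijective v₁ hv₁0).1
    have hf₂0 : f₂ ≠ 0 := fun h => hf₁'0 (hφinj (by rw [map_zero]; exact h))
    have hg₂0 : g₂ ≠ 0 := fun h => hg₁0 (hφinj (by rw [map_zero]; exact h))
    have hf₂d : f₂.totalDegree ≤ d := (totalDegree_dirSubst_le v₁ f₁').trans hf₁'d
    have hg₂d : g₂.totalDegree ≤ δ := (totalDegree_dirSubst_le v₁ g₁).trans hg₁d
    have hcop₂ : IsRelPrime f₂ g₂ := isRelPrime_dirSubst v₁ hv₁0 hcop₁'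
    have hZ₂ : (Finset.univ.filter fun x : Fin (n + 1) → K => eval x f₁' = 0 ∧ eval x g₁ = 0).card =
        (Finset.univ.filter fun x : Fin (n + 1) → K => eval x f₂ = 0 ∧ eval x g₂ = 0).card := by
      have hψ : Function.Bijective (fun x : Fin (n + 1) → K =>
          (Fin.cases (v₁ 0 * x 0) (fun j => x j.succ + v₁ j.succ * x 0) : Fin (n + 1) → K)) :=
        Finite.injective_iff_bijective.1 (dirMap_injective v₁ hv₁0)
      rw [← card_filter_comp _ hψ (fun x : Fin (n + 1) → K => eval x f₁' = 0 ∧ eval x g₁ = 0)]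
      simp only [f₂, g₂, φ, eval_dirSubst]
    rw [hZ₂]
    -- Step 4: single out `X 0`; the resultant and its properties.
    set F := finSuccEquiv K n f₂ with hF
    set G := finSuccEquiv K n g₂ with hG
    have hFc : F.coeff d = 1 := by
      rw [hF, hf₂, hφ, coeff_finSuccEquiv_dirSubst v₁ f₁' hf₁'d, hline', map_one]
    have hFle : F.natDegree ≤ d := by
      rw [hF, natDegree_finSuccEquiv]
      exact (degreeOf_le_totalDegree _ _).trans hf₂d
    have hFn : F.natDegree = d :=
      le_antisymm hFle (Polynomial.le_natDegree_of_ne_zero (by rw [hFc]; exact one_ne_zero))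
    have hFm : F.Monic := by
      rw [Polynomial.Monic, Polynomial.leadingCoeff, hFn, hFc]
    have hGn : G.natDegree ≤ δ := by
      rw [hG, natDegree_finSuccEquiv]
      exact (degreeOf_le_totalDegree _ _).trans hg₂d
    have hFG : IsRelPrime F G := isRelPrime_map_mulEquiv (finSuccEquiv K n).toMulEquiv hcop₂
    set R := Polynomial.resultant F G d G.natDegree with hR
    have hR0 : R ≠ 0 := resultant_ne_zero_of_isRelPrime hFm hFn le_rfl hFG
    have hRd : R.totalDegree ≤ d * δ :=
      totalDegree_resultant_le F G d δ G.natDegree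
        (fun i hi => (totalDegree_coeff_finSuccEquiv_add_le f₂ i hi).trans hf₂d)
        (fun i hi => (totalDegree_coeff_finSuccEquiv_add_le g₂ i hi).trans hg₂d)
    -- Step 5: fibres over `a ∈ K^n` and the multiplicity Schwartz–Zippel bound.
    set T : (Fin n → K) → Finset K := fun a =>
      Finset.univ.filter fun t => (F.map (eval a)).IsRoot t ∧ (G.map (eval a)).IsRoot t with hT
    have hTa : ∀ a, aeval (fun i => X i + C (a i)) R ∈ idealOfVars (Fin n) K ^ (T a).card :=
      fun a => shift_mem_pow_idealOfVars a _ (resultant_mem_pow_ker_eval F G hFm hFn le_rfl a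
        (T a) (fun t ht => (Finset.mem_filter.1 ht).2))
    have hsum : ∑ a, (T a).card ≤ R.totalDegree * q ^ (n - 1) :=
      multiplicity_schwartz_zippel hR0 _ hTa
    have hZ₃ : (Finset.univ.filter fun x : Fin (n + 1) → K => eval x f₂ = 0 ∧ eval x g₂ = 0).card =
        ∑ a, (T a).card := by
      rw [card_filter_eq_sum_cons]
      refine Finset.sum_congr rfl fun a _ => ?_
      rw [hT]
      congr 1
      refine Finset.filter_congr fun t _ => ?_
      rw [eval_eq_eval_mv_eval', eval_eq_eval_mv_eval', Polynomial.IsRoot.def, Polynomial.IsRoot.def]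
    rw [hZ₃]
    calc ∑ a, (T a).card ≤ R.totalDegree * q ^ (n - 1) := hsum
      _ ≤ d * δ * q ^ (n - 1) := by gcongr
      _ ≤ δ ^ 2 * q ^ (n + 1 - 2) := by
          rw [show n + 1 - 2 = n - 1 by omega, sq]
          gcongr

end CafureMateraLemma22

/-- **Cafure–Matera (2006), Lemma 2.2 (case `s = 2`), proved.** Two nonzero polynomials
`f, g ∈ 𝔽_q[X₁,…,Xₙ]` of degree `≤ δ` without a common factor over `𝔽̄_q` have at most
`δ² q^{n-2}` common `𝔽_q`-rational zeros. [cite: CafureMatera2006, Lemma 2.2] -/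
theorem CafureMatera2006_lemma22_holds : CafureMatera2006_lemma22 := by
  intro K _ _ _ N δ f g hf hg hδ hfd hgd hcop
  exact CafureMateraLemma22.card_commonZero_le N δ f g hf hg hδ hfd hgd
    (CafureMateraLemma22.isRelPrime_of_map _ hcop)

end Literature.NumberTheory.DiophantineGeometry
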